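import Summits.NavierStokesRegularity.NavierStokesRegularity.Theorems.ScenarioCensusRowF1ax
import Literature.Analysis.FluidPDE.BarkerPrange2020VorticityAlignmentTypeIHolds
import HarnessLib

/-!
# Census row F1, family «SLACK / COLUMNAR TOP» (F1sd ⊆ F1co; F1sv ⊆ F1vs ⊆ F1va) — LINE «columnar-top» port, part 1/4: the slack hypotheses,
# the rows, the floor `GenuinelyThreeDTop`, the residual `ColumnarCollapse` (≡ Row_F1), the split of `Row_F1`

Re-homed for the scenario census (typer seat ns-census-typer-1 g7; the cells F1sd ⊆ F1co and F1sv ⊆ F1vs ⊆ F1va are MEMBERS OF RECORD «DECIDED IN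
KERNEL IN FILES» of row F1 since census v1.68 (critic idea-crit-3 PASS 19:19:37Z; ref ns-census-ref g8 PRE-CHECK ✓ §13.14 [2/6]; lit §21.20); this port makes
them TREE-decided): VERBATIM PORT of ns-idea-3 LINE 15 «columnar-top», `pub/ideators/ns-idea-3/lines/columnar-top/line-columnar-top.lean` sha16
c9a7d5b1dc6ba717 (818 l., lean check rc 0, 0 sorry), split for the 400-line rule into `ScenarioCensusRowF1Columnar` (§1) → `…ColumnarZoom` (§2) →
`…ColumnarTransfer` (§3) → `…ColumnarTop` (§4 + census KEYS).  Lean text VERBATIM in namespace `…Theorems.ScenarioCensus.ColumnarTop` (the line's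
`…Cruxes.ScenarioCensusRowF1.ColumnarTopLine` re-homed); port edits: `@[conjecture]` on the residual `ColumnarCollapse` (≡ `ScenarioCensus.Row_F1`, OPEN),
three one-line docstrings added.

No census VALUE is moved here (row F1 stays OPEN-WITH-LINE; the members become TREE-decided by name); NS regularity is NOT proved; `Row_F1` is
untouched (zero movement, `columnarCollapse_iff_rowF1`); no summit statement is proved by this file.
-/

-- the summit and its single problem share the name `NavierStokesRegularity` (D-0017 nested layout)
set_option linter.dupNamespace false

noncomputable section

open MeasureTheory Set Function Filter TopologicalSpace Metric
open scoped Topology NNReal ENNReal InnerProductSpace RealInnerProductSpace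

namespace Summit.NavierStokesRegularity.NavierStokesRegularity.Theorems.ScenarioCensus.ColumnarTop

open Literature.Analysis Literature.Analysis.FluidPDE
open Summit.NavierStokesRegularity.NavierStokesRegularity.Theorems

/-- `ℝ³`. -/
abbrev E3 := EuclideanSpace ℝ (Fin 3)

/-! ## §1 Slack hypotheses on the top, the rows, the floor, the residual, the split of `Row_F1` -/

/-- **Subcritical (moving) speed level**: `Λ(t) √(T − t) → 0` as `t ↑ T` (constant levels included; the
Type-I scale `(T − t)^{-1/2}` excluded). -/
def IsSubcriticalLevel (T : ℝ) (Λ : ℝ → ℝ) : Prop :=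
  Tendsto (fun t => Λ t * Real.sqrt (T - t)) (𝓝[<] T) (𝓝 0)

/-- **Slack direction `e` on the top at level `Λ`**: for every `ε > 0`, eventually as `t ↑ T`,
`(T − t) ‖∂_e u(t, x)‖ ≤ ε` at every point where the speed exceeds `Λ t`. -/
def HasSlackDirectionAt (T : ℝ) (Λ : ℝ → ℝ) (e : E3) (u : ℝ → E3 → E3) : Prop :=
  ∀ ε : ℝ, 0 < ε → ∀ᶠ t in 𝓝[<] T, ∀ x : E3, Λ t < ‖u t x‖ → (T - t) * ‖fderiv ℝ (u t) x e‖ ≤ ε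

/-- **Vorticity axis `e` on the top at level `Λ`**: for every `ε > 0`, eventually as `t ↑ T`, the component
of the vorticity orthogonal to `e` is `≤ ε / (T − t)` at every `Λ t`-fast point. -/
def HasVorticityAxisAt (T : ℝ) (Λ : ℝ → ℝ) (e : E3) (u : ℝ → E3 → E3) : Prop :=
  ∀ ε : ℝ, 0 < ε → ∀ᶠ t in 𝓝[<] T, ∀ x : E3, Λ t < ‖u t x‖ →
    (T - t) * ‖curl (u t) x - ⟪curl (u t) x, e⟫_ℝ • e‖ ≤ ε

/-- **Slack vorticity on the top at level `Λ`**: for every `ε > 0`, eventually as `t ↑ T`,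
`(T − t) ‖ω(t, x)‖ ≤ ε` at every `Λ t`-fast point. -/
def HasSlackVorticityAt (T : ℝ) (Λ : ℝ → ℝ) (u : ℝ → E3 → E3) : Prop :=
  ∀ ε : ℝ, 0 < ε → ∀ᶠ t in 𝓝[<] T, ∀ x : E3, Λ t < ‖u t x‖ → (T - t) * ‖curl (u t) x‖ ≤ ε

/-- **Columnar top**: some subcritical level and some unit direction with slack. -/
def HasColumnarTop (T : ℝ) (u : ℝ → E3 → E3) : Prop :=
  ∃ Λ : ℝ → ℝ, IsSubcriticalLevel T Λ ∧ ∃ e : E3, ‖e‖ = 1 ∧ HasSlackDirectionAt T Λ e u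

/-- **Vorticity axis on the top**: some subcritical level and some unit axis. -/
def HasVorticityAxisTop (T : ℝ) (u : ℝ → E3 → E3) : Prop :=
  ∃ Λ : ℝ → ℝ, IsSubcriticalLevel T Λ ∧ ∃ e : E3, ‖e‖ = 1 ∧ HasVorticityAxisAt T Λ e u

/-- **Slack vorticity on the top**: some subcritical level. -/
def HasSlackVorticityTop (T : ℝ) (u : ℝ → E3 → E3) : Prop :=
  ∃ Λ : ℝ → ℝ, IsSubcriticalLevel T Λ ∧ HasSlackVorticityAt T Λ u

/-- **Global slack direction** (level-free): `(T − t) sup_x ‖∂_e u(t, x)‖ → 0` for one unit `e`. -/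
def HasSlackDirection (T : ℝ) (u : ℝ → E3 → E3) : Prop :=
  ∃ e : E3, ‖e‖ = 1 ∧ ∀ ε : ℝ, 0 < ε → ∀ᶠ t in 𝓝[<] T, ∀ x : E3, (T - t) * ‖fderiv ℝ (u t) x e‖ ≤ ε

/-- **Global sub-Type-I vorticity** (level-free): `(T − t) ‖ω(t)‖_∞ → 0`. -/
def HasSlackVorticity (T : ℝ) (u : ℝ → E3 → E3) : Prop :=
  ∀ ε : ℝ, 0 < ε → ∀ᶠ t in 𝓝[<] T, ∀ x : E3, (T - t) * ‖curl (u t) x‖ ≤ ε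

/-- Constant levels are subcritical. -/
theorem isSubcriticalLevel_const (T Λ : ℝ) : IsSubcriticalLevel T (fun _ => Λ) := by
  have h : Tendsto (fun t : ℝ => Λ * Real.sqrt (T - t)) (𝓝 T) (𝓝 (Λ * Real.sqrt (T - T))) :=
    ((continuous_const.sub continuous_id).sqrt.tendsto T).const_mul Λ
  rw [sub_self, Real.sqrt_zero, mul_zero] at h
  exact h.mono_left nhdsWithin_le_nhds

/-- The component orthogonal to a unit vector is not longer than the vector. -/
theorem norm_sub_inner_smul_le (v : E3) {e : E3} (he : ‖e‖ = 1) : ‖v - ⟪v, e⟫_ℝ • e‖ ≤ ‖v‖ := by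
  have h1 : ‖v - ⟪v, e⟫_ℝ • e‖ ^ 2 = ‖v‖ ^ 2 - ⟪v, e⟫_ℝ ^ 2 := by
    rw [norm_sub_sq_real, real_inner_smul_right, norm_smul, he, mul_one, Real.norm_eq_abs, sq_abs]
    ring
  have h2 : ‖v - ⟪v, e⟫_ℝ • e‖ ^ 2 ≤ ‖v‖ ^ 2 := by
    rw [h1]
    nlinarith [sq_nonneg ⟪v, e⟫_ℝ]
  exact le_of_pow_le_pow_left₀ two_ne_zero (norm_nonneg _) h2

/-- Slack vorticity gives every unit vector as a vorticity axis. -/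
theorem HasSlackVorticityAt.hasVorticityAxisAt {T : ℝ} {Λ : ℝ → ℝ} {u : ℝ → E3 → E3}
    (h : HasSlackVorticityAt T Λ u) {e : E3} (he : ‖e‖ = 1) : HasVorticityAxisAt T Λ e u := by
  intro ε hε
  filter_upwards [h ε hε] with t ht x hx
  have hTt : 0 ≤ T - t ∨ T - t < 0 := le_or_gt 0 (T - t)
  rcases hTt with hTt | hTt
  · exact (mul_le_mul_of_nonneg_left (norm_sub_inner_smul_le _ he) hTt).trans (ht x hx)
  · exact (mul_nonpos_of_nonpos_of_nonneg hTt.le (norm_nonneg _)).trans hε.le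

/-- Slack vorticity on the top gives a vorticity axis on the top (axis `e₀`). -/
theorem HasSlackVorticityTop.hasVorticityAxisTop {T : ℝ} {u : ℝ → E3 → E3}
    (h : HasSlackVorticityTop T u) : HasVorticityAxisTop T u := by
  obtain ⟨Λ, hΛ, hs⟩ := h
  have he : ‖(EuclideanSpace.single (0 : Fin 3) (1 : ℝ) : E3)‖ = 1 := by simp
  exact ⟨Λ, hΛ, _, he, hs.hasVorticityAxisAt he⟩

/-- A global slack direction is a columnar top (at the constant level `0`). -/
theorem HasSlackDirection.hasColumnarTop {T : ℝ} {u : ℝ → E3 → E3} (h : HasSlackDirection T u) :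
    HasColumnarTop T u := by
  obtain ⟨e, he, hs⟩ := h
  refine ⟨fun _ => 0, isSubcriticalLevel_const T 0, e, he, fun ε hε => ?_⟩
  filter_upwards [hs ε hε] with t ht x _ using ht x

/-- Global sub-Type-I vorticity is slack vorticity on the top (at the constant level `0`). -/
theorem HasSlackVorticity.hasSlackVorticityTop {T : ℝ} {u : ℝ → E3 → E3} (h : HasSlackVorticity T u) :
    HasSlackVorticityTop T u := by
  refine ⟨fun _ => 0, isSubcriticalLevel_const T 0, fun ε hε => ?_⟩
  filter_upwards [h ε hε] with t ht x _ using ht x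

/-- **Criterion row F1co** (Type I · no symmetry · Clay class · COLUMNAR TOP ⇒ extension past `T`):
the frame of `ScenarioCensus.Row_F1` verbatim plus `HasColumnarTop T u`.  PROVED (`rowF1co_holds`). -/
def Row_F1co : Prop :=
  ∀ (ν T : ℝ), 0 < ν → 0 < T →
    ∀ (u : ℝ → E3 → E3) (p : ℝ → E3 → ℝ),
    IsClassicalNSSolutionOn (Ico 0 T) ν 0 u p → IsLerayHopfOn T ν 0 (u 0) u →
    HasRapidSpatialDecay (u 0) → IsTypeIBlowup u T → HasColumnarTop T u →
    HasSmoothExtensionPast ν 0 u T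

/-- **Criterion row F1sd** (… · GLOBAL SLACK DIRECTION `(T−t)‖∂_e u(t)‖_∞ → 0` ⇒ extension).  PROVED. -/
def Row_F1sd : Prop :=
  ∀ (ν T : ℝ), 0 < ν → 0 < T →
    ∀ (u : ℝ → E3 → E3) (p : ℝ → E3 → ℝ),
    IsClassicalNSSolutionOn (Ico 0 T) ν 0 u p → IsLerayHopfOn T ν 0 (u 0) u →
    HasRapidSpatialDecay (u 0) → IsTypeIBlowup u T → HasSlackDirection T u →
    HasSmoothExtensionPast ν 0 u T

/-- **Criterion row F1va** (… · VORTICITY AXIS ON THE TOP ⇒ extension).  PROVED (`rowF1va_holds`). -/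
def Row_F1va : Prop :=
  ∀ (ν T : ℝ), 0 < ν → 0 < T →
    ∀ (u : ℝ → E3 → E3) (p : ℝ → E3 → ℝ),
    IsClassicalNSSolutionOn (Ico 0 T) ν 0 u p → IsLerayHopfOn T ν 0 (u 0) u →
    HasRapidSpatialDecay (u 0) → IsTypeIBlowup u T → HasVorticityAxisTop T u →
    HasSmoothExtensionPast ν 0 u T

/-- **Criterion row F1vs** (… · SLACK VORTICITY ON THE TOP ⇒ extension).  PROVED. -/
def Row_F1vs : Prop :=
  ∀ (ν T : ℝ), 0 < ν → 0 < T →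
    ∀ (u : ℝ → E3 → E3) (p : ℝ → E3 → ℝ),
    IsClassicalNSSolutionOn (Ico 0 T) ν 0 u p → IsLerayHopfOn T ν 0 (u 0) u →
    HasRapidSpatialDecay (u 0) → IsTypeIBlowup u T → HasSlackVorticityTop T u →
    HasSmoothExtensionPast ν 0 u T

/-- **Criterion row F1sv** (… · GLOBAL SUB-TYPE-I VORTICITY `(T−t)‖ω(t)‖_∞ → 0` ⇒ extension).  PROVED. -/
def Row_F1sv : Prop :=
  ∀ (ν T : ℝ), 0 < ν → 0 < T →
    ∀ (u : ℝ → E3 → E3) (p : ℝ → E3 → ℝ),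
    IsClassicalNSSolutionOn (Ico 0 T) ν 0 u p → IsLerayHopfOn T ν 0 (u 0) u →
    HasRapidSpatialDecay (u 0) → IsTypeIBlowup u T → HasSlackVorticity T u →
    HasSmoothExtensionPast ν 0 u T

/-- **GENUINELY 3D TOP** (structural floor, maximal frame): a maximal classical Leray–Hopf solution from a
rapidly decaying datum blowing up at the Type-I rate has neither a columnar top nor a vorticity axis on its
top.  PROVED (`genuinelyThreeDTop_holds`). -/
def GenuinelyThreeDTop : Prop :=
  ∀ (ν T : ℝ), 0 < ν → 0 < T →
    ∀ (u : ℝ → E3 → E3) (p : ℝ → E3 → ℝ),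
    IsMaximalSmoothSolution ν 0 u p T → IsLerayHopfOn T ν 0 (u 0) u →
    HasRapidSpatialDecay (u 0) → IsTypeIBlowup u T → ¬ HasColumnarTop T u ∧ ¬ HasVorticityAxisTop T u

/-- **Residual** (maximal frame): every Type-I Clay blow-up has a global slack direction.  DECLARED ≡ row F1
(`columnarCollapse_iff_rowF1`); no movement on `Row_F1` is claimed. -/
@[conjecture] def ColumnarCollapse : Prop :=
  ∀ (ν T : ℝ), 0 < ν → 0 < T →
    ∀ (u : ℝ → E3 → E3) (p : ℝ → E3 → ℝ),
    IsMaximalSmoothSolution ν 0 u p T → IsLerayHopfOn T ν 0 (u 0) u →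
    HasRapidSpatialDecay (u 0) → IsTypeIBlowup u T → HasSlackDirection T u

/-- F1co contains F1sd. -/
theorem rowF1sd_of_rowF1co (h : Row_F1co) : Row_F1sd :=
  fun ν T hν hT u p hsol hLH hdec hTI hs => h ν T hν hT u p hsol hLH hdec hTI hs.hasColumnarTop

/-- F1va contains F1vs. -/
theorem rowF1vs_of_rowF1va (h : Row_F1va) : Row_F1vs :=
  fun ν T hν hT u p hsol hLH hdec hTI hs => h ν T hν hT u p hsol hLH hdec hTI hs.hasVorticityAxisTop

/-- F1vs contains F1sv. -/
theorem rowF1sv_of_rowF1vs (h : Row_F1vs) : Row_F1sv :=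
  fun ν T hν hT u p hsol hLH hdec hTI hs => h ν T hν hT u p hsol hLH hdec hTI hs.hasSlackVorticityTop

/-- **The split**: criterion + residual ⇒ row F1 (by cases on extendability). -/
theorem rowF1_of (hD : Row_F1sd) (hR : ColumnarCollapse) : ScenarioCensus.Row_F1 := by
  unfold ScenarioCensus.Row_F1
  intro ν T hν hT u p hsol hLH hdec hTI
  by_contra hext
  exact hext (hD ν T hν hT u p hsol hLH hdec hTI (hR ν T hν hT u p ⟨hsol, hext⟩ hLH hdec hTI))

/-- The residual is a consequence of the row (vacuously: under `Row_F1` no maximal solution is Type I). -/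
theorem columnarCollapse_of_rowF1 (h : ScenarioCensus.Row_F1) : ColumnarCollapse :=
  fun ν T hν hT u p hmax hLH hdec hTI => (hmax.2 (h ν T hν hT u p hmax.1 hLH hdec hTI)).elim

end Summit.NavierStokesRegularity.NavierStokesRegularity.Theorems.ScenarioCensus.ColumnarTop

end
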